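/-
Copyright (c) 2026 the pub-hodgecm-mathlib formalisation cell (harness21).  Prover seat hodgecm-mathlib-LH4-p09 (g8), req620 Track A «(D-RAM) FOUR-FRAME» squad
(heir LEAD F0P3a-plan (g20) T19-24 «STAGE-1b PRE-SCOPING BY IDLE HANDS: ALLOWED AS SCOPING»; dealer LH4-plan (g12)).  2026-09-04.
-/
import Summits.HodgeConjecture.HodgeConjecture.Theorems.F0P3cDyRamKappaSumSignClasses          -- ★ p855136 (LH4-p11 (g0)): `kappaChar_eq_chi_signClass`; brings ★ p855115 `…StableSumSignClasses` (`exists_rep_of_dichotomy`, `sum_signClasses_eq_sum_add_sum`)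
import Summits.HodgeConjecture.HodgeConjecture.Theorems.F0P3cDyRamDiagonalOrbitCountLabelled   -- ★ p858820 (this seat): labelled Stage A; brings ★ p858764 `…LevelCountDiagonalModel` (MASTER head, (C) with a label, `ncard_levels_conj_diagonal`)
import HarnessLib

/-!
# Crux `H413`, line LH4 «(D-RAM) FOUR-FRAME» road — STAGE-1b SCOPING BRICK «(L-model-S)»: THE EIGHTFOLD SYMMETRISATION OF THE FOUR-FRAME SUM WITH A LABEL
# (steps (2a)(2b) of the (S)∕(K) reductions of record — four frames ↔ the eight sign classes `(F^× ∕ N E^×)³` — for the label-cut ∕ level censuses), and the composite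
# with ★ p858820: the STABLE four-frame LEVELS census is `4·` the labelled Stage-B sum

Cell `hodgecm-mathlib` (D-0151), FLOOR 0, crux item H413 = `stmt-HodgeConjecture-24833`, route of record `HCCMUnconditional`; squad F0∕P3c∕LH4 (req618∕req620).
THEOREMS ONLY (no `def`, no instance, no notation, no `sorry`, default heartbeats); lane `--supports stmt-HodgeConjecture-24833 --as helper` (count-neutral).
Consumers: the STAGE-1b producers of the tier-0 rows `stub_rows_transvPlus ∕ _transvMinus ∕ _regular` (type-(1) level laws (F2)∕(F3) of F0P3a-p01 (g35)'s SIGSHEET-1b draft, in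
LH4-p06 (g6)'s `#levels_{a,c}` currency).  ★ p858764 (L-model) puts every frame's level census in a unit diagonal model `diag(d^{(b)})`, ★ p858820 (L-model-A) is Stage A for
the EIGHT-CLASS label-cut sum `Σ_s #{M : type t for diag(d_s), T·M = M, Q M}`; this file is the link between the two — the labelled twin of ★ `F0P3cDyRamStableSumSignClasses` ∕
★ `F0P3cDyRamKappaSumSignClasses` — and the composite.

THE MATHEMATICS ([Rogawski1990, §3.6, §4.9]; [LanglandsShelstad1987, §1.3]; [Jacobowitz1962, §4]; [Kottwitz1986BaseChangeUnits, §1]).  `c` a `σ`-fixed unit with the index-two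
dictionary (`F^× = N E^× ⊔ c·N E^×`), `d_s i = c` if `s i` else `1` (`s : Fin 3 → Bool`), `T` diagonal, `Q` a label of lattices invariant under DIAGONAL changes of basis
(`Q (P·M) ↔ Q M` for `P = diag(z) ∈ GL₃`; every level token of a diagonal operator is one, ★ `latticeInLevel_diagonal_mapGL_iff`), `C_Q(s) := #{M : type t for diag(d_s), T·M = M, Q M}`.
(B_Q) `C_Q(s) = C_Q(¬s)`: the scalar `c` of the form changes no vertex (★ `isVertexLattice_smul_iff`) and `diag(c·d_{¬s})` is entrywise congruent to `diag(d_s)` by a diagonal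
`diag(z)`, which commutes with `T` and fixes `Q` (★ p858764 (C) `ncard_vertex_fixed_sep_diagonal_eq_of_exists_norm`) (§1).  Hence (§2) for ANY frame counts `n : Fin 4 → ℕ` with
(A_Q) «`n_b = C_Q(s_ω(b))`, `s_ω(b) = (ε₁(b) = −1, ε₂(b) = −1, (ε₁ε₂)(b) = −1 XOR ω)`» one gets `2·Σ_b n_b = Σ_s C_Q(s)` and `2·Σ_b κ_i(b)·n_b = Σ_s χ_i(s)·C_Q(s)` by ★'s eightfold
bookkeeping (`sum_signClasses_eq_sum_add_sum`, `kappaChar_eq_chi_signClass`) VERBATIM.  (A_Q) holds for the LEVELS census of a four-frame family (§3): ★ p858764's MASTER model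
`ᵗσ(A)Φ₃A = diag(d)`, `Γ_b = A·diag(α,β,1)·A⁻¹` carries `#{M : type t for Φ₃, Γ_b·M = M, (Γ_b−1)M ⊆ ϖ^aM, (Γ_b−1)²M ⊆ ϖ^{c′}M}` to the `diag(d)`-count with the DIAGONAL
operators `D₁ = diag(α−1, β−1, 0)`, `D₂ = D₁²` (★ `ncard_levels_conj_diagonal`), `d` has the classes of the frame (★ #0a H7), and (C) moves `diag(d)` to `diag(d_{s_ω(b)})`.
So (§4) `2·Σ_b levels(Γ_b) = Σ_s C_levels(s)` (and the κ-twin), and with ★ p858820's labelled Stage A (`↑Σ_s C_levels(s) = 8·Σᶠ_{M₀ ∈ 𝓛₀(T), levels} n_t(M₀)·w(M₀)`):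
`Σ_b levels(Γ_b) = 4·Σᶠ_{M₀ ∈ 𝓛₀(diag(α,β,1)), D₁M₀ ⊆ ϖ^aM₀ ∧ D₂M₀ ⊆ ϖ^{c′}M₀} polarisationCount σ ϖ t M₀ · stabiliserWeight σ M₀` — the stable LEVEL law is a labelled B10.
* §1 `ncard_vertex_fixed_sep_diagonal_smul_eq`, `ncard_fixed_sep_signClass_eq_compl` ((B_Q)).
* §2 `two_mul_sum_eq_sum_signClasses_of_frame_counts`, `two_mul_sum_kappaChar_mul_eq_sum_signClasses_of_frame_counts` (generic label, abstract frame counts).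
* §3 `levels_diagonalGL_mapGL_iff`, `ncard_levels_frameElt_eq_ncard_signClass` ((A_Q) for the levels census).
* §4 `two_mul_sum_levelsCount_eq_sum_signClasses`, `two_mul_sum_kappaChar_mul_levelsCount_eq_sum_signClasses`, HEAD `sum_levelsCount_eq_four_mul_finsum_polarisationCount_mul_stabiliserWeight`.
HONEST LABEL.  Count-neutral (`--supports`); bookkeeping over ★ files, nothing printed is asserted; pays NO tier-0 row; the κ-side Stage A with a label and every Stage-B table
are NOT here; the census laws stay PROVER TARGETS; `HC_CM` is proved only modulo the 7 printed citations (2 remaining named inputs: hLiu418 = `stmt-HodgeConjecture-24832`, h413 =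
`stmt-HodgeConjecture-24833`) until rung 0 closes.

## References
* [Rogawski1990] J. D. Rogawski, *Automorphic Representations of Unitary Groups in Three Variables*, Ann. of Math. Stud. 123 (1990), §3.6 pp. 28–29 (elliptic tori, the classes in a
  stable class), §4.9 Prop. 4.9.1 (a)(b) p. 55 (orbital integrals as fixed-lattice counts).
* [LanglandsShelstad1987] R. P. Langlands, D. Shelstad, *On the definition of transfer factors*, Math. Ann. 278 (1987), §1.3 (the classes in a stable class).
* [Jacobowitz1962] R. Jacobowitz, *Hermitian forms over local fields*, Amer. J. Math. 84 (1962), §4 (diagonal forms, norm classes of the coefficients).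
* [Kottwitz1986BaseChangeUnits] R. E. Kottwitz, *Base change for unit elements of Hecke algebras*, Compositio Math. 60 (1986), §1 pp. 240–241 (fixed-lattice counting).
-/

set_option autoImplicit false

noncomputable section

namespace Summit.HodgeConjecture.HodgeConjecture.Cruxes.H413.F0P3cDyRamLevelSumSignClasses

open Literature.NumberTheory.Automorphic Literature.NumberTheory.Automorphic.HermitianLattice Literature.NumberTheory.Automorphic.UnitaryGroup
open Literature.NumberTheory.Automorphic.UnitaryLatticeTree Literature.NumberTheory.Automorphic.UnitaryThreeFourFrame
open Summit.HodgeConjecture.HodgeConjecture.Cruxes.H413.F0P3cDyRamFixedCountDiagonalModel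
open Summit.HodgeConjecture.HodgeConjecture.Cruxes.H413.F0P3cDyRamStableSumSignClasses
open Summit.HodgeConjecture.HodgeConjecture.Cruxes.H413.F0P3cDyRamKappaSumSignClasses
open Summit.HodgeConjecture.HodgeConjecture.Cruxes.H413.F0P3cDyRamFourFrameCensusDefs
open Summit.HodgeConjecture.HodgeConjecture.Cruxes.H413.F0P3cDyRamLevelCountDiagonalModel
open Summit.HodgeConjecture.HodgeConjecture.Cruxes.H413.F0P3cDyRamDiagonalTorusDefs
open Summit.HodgeConjecture.HodgeConjecture.Cruxes.H413.F0P3cDyRamDiagonalStrataDefs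
open Summit.HodgeConjecture.HodgeConjecture.Cruxes.H413.F0P3cDyRamDiagonalOrbitCountLabelled
open scoped Valued WithZero Matrix MatrixGroups

/-! ## §1  (B_Q): the label-cut count of a sign class equals that of the complementary class -/

section Compl

variable {K : Type} [Field K] [Valued K ℤᵐ⁰]

/-- A unit scalar of a diagonal form does not change a label-cut fixed count (the label does not see the form; ★ `isVertexLattice_smul_iff`). [cite: Jacobowitz1962, §4] -/
theorem ncard_vertex_fixed_sep_diagonal_smul_eq (σ : K →+* K) (ϖ : K) {c : K} (hc : Valued.v c = 1) (d : Fin 3 → K) (T : GL (Fin 3) K) (t : ℕ)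
    (Q : Submodule 𝒪[K] (Fin 3 → K) → Prop) :
    {M : Submodule 𝒪[K] (Fin 3 → K) | IsVertexLattice σ ϖ (Matrix.diagonal (c • d)) t M ∧ mapGL T M = M ∧ Q M}.ncard =
      {M : Submodule 𝒪[K] (Fin 3 → K) | IsVertexLattice σ ϖ (Matrix.diagonal d) t M ∧ mapGL T M = M ∧ Q M}.ncard := by
  rw [Matrix.diagonal_smul]
  simp only [isVertexLattice_smul_iff (σ := σ) (ϖ := ϖ) hc]

/-- **(B_Q) `C_Q(s) = C_Q(¬s)`** for a `σ`-fixed unit `c`, a DIAGONAL `T` and a label `Q` invariant under diagonal changes of basis: the representative forms `diag(d_s)` and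
`diag(d_{¬s})` have the same label-cut `T`-fixed type-`t` counts (`c·diag(d_{¬s})` is entrywise congruent to `diag(d_s)` by `z = 1`, `z = c`; ★ p858764 (C)).
[cite: Jacobowitz1962, §4] [cite: Rogawski1990, §3.6 pp. 28–29] -/
theorem ncard_fixed_sep_signClass_eq_compl (σ : K →+* K) (ϖ : K) {c : K} (hσc : σ c = c) (hvc : Valued.v c = 1)
    (s : Fin 3 → Bool) (e : Fin 3 → K) (T : GL (Fin 3) K) (hT : (T : Matrix (Fin 3) (Fin 3) K) = Matrix.diagonal e) (t : ℕ)
    (Q : Submodule 𝒪[K] (Fin 3 → K) → Prop)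
    (hQ : ∀ (P : GL (Fin 3) K) (z : Fin 3 → K), (P : Matrix (Fin 3) (Fin 3) K) = Matrix.diagonal z → ∀ M, Q (mapGL P M) ↔ Q M) :
    {M : Submodule 𝒪[K] (Fin 3 → K) | IsVertexLattice σ ϖ (Matrix.diagonal fun i => if s i then c else (1 : K)) t M ∧ mapGL T M = M ∧ Q M}.ncard =
      {M : Submodule 𝒪[K] (Fin 3 → K) | IsVertexLattice σ ϖ (Matrix.diagonal fun i => if (!s i) then c else (1 : K)) t M ∧ mapGL T M = M ∧ Q M}.ncard := by
  have hc0 : c ≠ 0 := fun h => by rw [h, map_zero] at hvc; exact zero_ne_one hvc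
  rw [← ncard_vertex_fixed_sep_diagonal_smul_eq σ ϖ hvc (fun i => if (!s i) then c else (1 : K)) T t Q]
  have h : ∀ i : Fin 3, ∃ z : K, z ≠ 0 ∧ σ z * (fun i => if s i then c else (1 : K)) i * z = (c • fun i => if (!s i) then c else (1 : K)) i := by
    intro i
    by_cases hs : s i
    · refine ⟨1, one_ne_zero, ?_⟩
      simp [hs, map_one]
    · refine ⟨c, hc0, ?_⟩
      simp [hs, hσc]
  exact (ncard_vertex_fixed_sep_diagonal_eq_of_exists_norm σ ϖ h e T hT t Q hQ).symm

end Compl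

/-! ## §2  The eightfold symmetrisation for abstract frame counts and a generic label -/

section Generic

variable {K : Type} [Field K] [Valued K ℤᵐ⁰] {σ : K →+* K} {ϖ : K}

/-- **THE LABELLED EIGHTFOLD SYMMETRISATION, STABLE SIDE, FOR ABSTRACT FRAME COUNTS.**  If each frame's count `n_b` is the label-cut model count of its sign class —
`n_b = C_Q(s_ω(b))`, `s_ω(b) = (ε₁(b) = −1, ε₂(b) = −1, (ε₁ε₂)(b) = −1 XOR ω)`, `ω = [ω(−1) = −1]` — then `2·Σ_b n_b = Σ_s C_Q(s)` (★ `sum_signClasses_eq_sum_add_sum` + (B_Q)).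
[cite: Rogawski1990, §3.6 pp. 28–29] [cite: LanglandsShelstad1987, §1.3] -/
theorem two_mul_sum_eq_sum_signClasses_of_frame_counts {c : K} (hσc : σ c = c) (hvc : Valued.v c = 1)
    (e : Fin 3 → K) (T : GL (Fin 3) K) (hT : (T : Matrix (Fin 3) (Fin 3) K) = Matrix.diagonal e) (t : ℕ)
    (Q : Submodule 𝒪[K] (Fin 3 → K) → Prop)
    (hQ : ∀ (P : GL (Fin 3) K) (z : Fin 3 → K), (P : Matrix (Fin 3) (Fin 3) K) = Matrix.diagonal z → ∀ M, Q (mapGL P M) ↔ Q M)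
    (n : Fin 4 → ℕ)
    (hA : ∀ b : Fin 4, n b = {M : Submodule 𝒪[K] (Fin 3 → K) |
        IsVertexLattice σ ϖ (Matrix.diagonal fun j => if (![(![false, false, true, true] : Fin 4 → Bool) b, (![false, true, false, true] : Fin 4 → Bool) b,
            xor ((![false, true, true, false] : Fin 4 → Bool) b) (decide (normSign σ (-1 : K) = -1))] : Fin 3 → Bool) j then c else (1 : K)) t M ∧
          mapGL T M = M ∧ Q M}.ncard) :
    2 * ∑ b : Fin 4, n b =
      ∑ s : Fin 3 → Bool, {M : Submodule 𝒪[K] (Fin 3 → K) | IsVertexLattice σ ϖ (Matrix.diagonal fun j => if s j then c else (1 : K)) t M ∧ mapGL T M = M ∧ Q M}.ncard := by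
  classical
  set ω : Bool := decide (normSign σ (-1 : K) = -1) with hω_def
  let sb : Fin 4 → Fin 3 → Bool := fun b =>
    ![(![false, false, true, true] : Fin 4 → Bool) b, (![false, true, false, true] : Fin 4 → Bool) b, xor ((![false, true, true, false] : Fin 4 → Bool) b) ω]
  let C : (Fin 3 → Bool) → ℕ := fun s =>
    {M : Submodule 𝒪[K] (Fin 3 → K) | IsVertexLattice σ ϖ (Matrix.diagonal fun j => if s j then c else (1 : K)) t M ∧ mapGL T M = M ∧ Q M}.ncard
  have hA' : ∀ b : Fin 4, n b = C (sb b) := hA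
  have hB : ∀ b : Fin 4, C (sb b) = C (fun j => !(sb b j)) := fun b => ncard_fixed_sep_signClass_eq_compl σ ϖ hσc hvc (sb b) e T hT t Q hQ
  calc 2 * ∑ b : Fin 4, n b
      = ∑ b : Fin 4, C (sb b) + ∑ b : Fin 4, C (fun j => !(sb b j)) := by
        rw [two_mul, Finset.sum_congr rfl fun b _ => hA' b]
        exact congrArg _ (Finset.sum_congr rfl fun b _ => hB b)
    _ = ∑ s : Fin 3 → Bool, C s := (sum_signClasses_eq_sum_add_sum ω C).symm

/-- **THE LABELLED EIGHTFOLD SYMMETRISATION, κ SIDE, FOR ABSTRACT FRAME COUNTS, EVERY SLOT `i`**: under the same (A_Q), with `w = ω(−1)` and the complement-invariant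
characters `χ₀(s) = w(−1)^{[s1]+[s2]}`, `χ₁(s) = w(−1)^{[s0]+[s2]}`, `χ₂(s) = (−1)^{[s0]+[s1]}`: `2·Σ_b κ_i(b)·n_b = Σ_s χ_i(s)·C_Q(s)` (★ `kappaChar_eq_chi_signClass` + (B_Q)).
[cite: Rogawski1990, §4.9 p. 55] [cite: LanglandsShelstad1987, §1.3] -/
theorem two_mul_sum_kappaChar_mul_eq_sum_signClasses_of_frame_counts {c : K} (hσc : σ c = c) (hvc : Valued.v c = 1)
    (e : Fin 3 → K) (T : GL (Fin 3) K) (hT : (T : Matrix (Fin 3) (Fin 3) K) = Matrix.diagonal e) (t : ℕ)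
    (Q : Submodule 𝒪[K] (Fin 3 → K) → Prop)
    (hQ : ∀ (P : GL (Fin 3) K) (z : Fin 3 → K), (P : Matrix (Fin 3) (Fin 3) K) = Matrix.diagonal z → ∀ M, Q (mapGL P M) ↔ Q M)
    (n : Fin 4 → ℕ)
    (hA : ∀ b : Fin 4, n b = {M : Submodule 𝒪[K] (Fin 3 → K) |
        IsVertexLattice σ ϖ (Matrix.diagonal fun j => if (![(![false, false, true, true] : Fin 4 → Bool) b, (![false, true, false, true] : Fin 4 → Bool) b,
            xor ((![false, true, true, false] : Fin 4 → Bool) b) (decide (normSign σ (-1 : K) = -1))] : Fin 3 → Bool) j then c else (1 : K)) t M ∧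
          mapGL T M = M ∧ Q M}.ncard) (i : Fin 3) :
    2 * ∑ b : Fin 4, kappaChar i b * (n b : ℤ) =
      ∑ s : Fin 3 → Bool,
        (![(if s 1 then -1 else 1) * (if s 2 then -1 else 1) * normSign σ (-1),
           (if s 0 then -1 else 1) * (if s 2 then -1 else 1) * normSign σ (-1),
           (if s 0 then -1 else 1) * (if s 1 then -1 else 1)] : Fin 3 → ℤ) i *
        ({M : Submodule 𝒪[K] (Fin 3 → K) |
          IsVertexLattice σ ϖ (Matrix.diagonal fun j => if s j then c else (1 : K)) t M ∧ mapGL T M = M ∧ Q M}.ncard : ℤ) := by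
  classical
  set ω : Bool := decide (normSign σ (-1 : K) = -1) with hω_def
  have hw : normSign σ (-1 : K) = if ω then -1 else 1 := by
    rcases normSign_eq_one_or σ (-1 : K) with hp | hm
    · have hωf : ω = false := by rw [hω_def, decide_eq_false_iff_not, hp]; norm_num
      rw [hp, hωf]; rfl
    · have hωt : ω = true := by rw [hω_def, decide_eq_true_eq, hm]
      rw [hm, hωt]; rfl
  let sb : Fin 4 → Fin 3 → Bool := fun b =>
    ![(![false, false, true, true] : Fin 4 → Bool) b, (![false, true, false, true] : Fin 4 → Bool) b, xor ((![false, true, true, false] : Fin 4 → Bool) b) ω]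
  let C : (Fin 3 → Bool) → ℕ := fun s =>
    {M : Submodule 𝒪[K] (Fin 3 → K) | IsVertexLattice σ ϖ (Matrix.diagonal fun j => if s j then c else (1 : K)) t M ∧ mapGL T M = M ∧ Q M}.ncard
  let χ : (Fin 3 → Bool) → ℤ := fun s =>
    (![(if s 1 then -1 else 1) * (if s 2 then -1 else 1) * normSign σ (-1),
       (if s 0 then -1 else 1) * (if s 2 then -1 else 1) * normSign σ (-1),
       (if s 0 then -1 else 1) * (if s 1 then -1 else 1)] : Fin 3 → ℤ) i
  have hA' : ∀ b : Fin 4, n b = C (sb b) := hA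
  have hB : ∀ b : Fin 4, C (sb b) = C (fun j => !(sb b j)) := fun b => ncard_fixed_sep_signClass_eq_compl σ ϖ hσc hvc (sb b) e T hT t Q hQ
  have hκ : ∀ b : Fin 4, kappaChar i b = χ (sb b) ∧ kappaChar i b = χ (fun j => !(sb b j)) := by
    intro b
    have h := kappaChar_eq_chi_signClass ω i b
    rw [← hw] at h
    exact h
  calc 2 * ∑ b : Fin 4, kappaChar i b * (n b : ℤ)
      = ∑ b : Fin 4, χ (sb b) * (C (sb b) : ℤ) + ∑ b : Fin 4, χ (fun j => !(sb b j)) * (C (fun j => !(sb b j)) : ℤ) := by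
        rw [two_mul, ← Finset.sum_add_distrib, ← Finset.sum_add_distrib]
        refine Finset.sum_congr rfl fun b _ => ?_
        rw [hA' b, ← (hκ b).1, ← (hκ b).2, ← hB b]
    _ = ∑ s : Fin 3 → Bool, χ s * (C s : ℤ) := (sum_signClasses_eq_sum_add_sum ω (fun s => χ s * (C s : ℤ))).symm

end Generic

/-! ## §3  (A_Q) for the LEVELS census: each frame's levels count is the levels model count of its sign class -/

section Levels

variable {K : Type} [Field K] [Valued K ℤᵐ⁰] {σ : K →+* K} {ϖ : K}

/-- The levels label with DIAGONAL operators is invariant under diagonal changes of basis (★ p858764 `latticeInLevel_diagonal_mapGL_iff`, twice).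
[cite: Kottwitz1986BaseChangeUnits, §1 pp. 240–241] -/
theorem levels_diagonalGL_mapGL_iff (ϖ : K) (a c' : ℕ) (e₁ e₂ : Fin 3 → K) (P : GL (Fin 3) K) (z : Fin 3 → K)
    (hP : (P : Matrix (Fin 3) (Fin 3) K) = Matrix.diagonal z) (M : Submodule 𝒪[K] (Fin 3 → K)) :
    (LatticeInLevel ϖ a (Matrix.diagonal e₁) (mapGL P M) ∧ LatticeInLevel ϖ c' (Matrix.diagonal e₂) (mapGL P M)) ↔
      (LatticeInLevel ϖ a (Matrix.diagonal e₁) M ∧ LatticeInLevel ϖ c' (Matrix.diagonal e₂) M) := by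
  rw [latticeInLevel_diagonal_mapGL_iff hP, latticeInLevel_diagonal_mapGL_iff hP]

/-- **(A_Q) FOR THE LEVELS CENSUS — each frame is counted by its sign class.**  Under the datum clauses, with `c` a `σ`-fixed unit satisfying the index-two dichotomy, for a
four-frame family `f`, `T = diag(α, β, 1)`, `Γ_b = frameElt σ f b α β`, `D₁ = diag(α−1, β−1, 0)`, `D₂ = diag((α−1)², (β−1)², 0)` and every vertex type `t`:
`#{M : type t for Φ₃, Γ_b·M = M, (Γ_b−1)M ⊆ ϖ^aM, (Γ_b−1)²M ⊆ ϖ^{c′}M} = #{M : type t for diag(d_{s_ω(b)}), T·M = M, D₁M ⊆ ϖ^aM, D₂M ⊆ ϖ^{c′}M}` (★ p858764 MASTER model +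
`ncard_levels_conj_diagonal`, the frame's classes ★ #0a H7, and (C) with the levels label to the class representative). [cite: Rogawski1990, §3.6 pp. 28–29; §4.9 Prop. 4.9.1 (a)(b) p. 55]
[cite: Jacobowitz1962, §4] [cite: Kottwitz1986BaseChangeUnits, §1 pp. 240–241] -/
theorem ncard_levels_frameElt_eq_ncard_signClass (hσ : ∀ x, σ (σ x) = x) (hvσ : ∀ a, Valued.v (σ a) = Valued.v a)
    (hϖ : Valued.v ϖ = WithZero.exp (-1 : ℤ)) (heven : ∀ x : K, σ x = x → x ≠ 0 → ∃ n : ℤ, Valued.v x = WithZero.exp (2 * n))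
    {c : K} (hσc : σ c = c) (hvc : Valued.v c = 1)
    (hdich : ∀ x : K, σ x = x → x ≠ 0 → (∃ z : K, z * σ z = x) ∨ ∃ z : K, z * σ z = c * x)
    {f : Fin 4 → Fin 3 → (Fin 3 → K)} (hf : IsFourFrameFamily σ f) (α β : K)
    (T : GL (Fin 3) K) (hT : (T : Matrix (Fin 3) (Fin 3) K) = Matrix.diagonal ![α, β, 1])
    (Γ : Fin 4 → GL (Fin 3) K) (hΓ : ∀ b, (Γ b : Matrix (Fin 3) (Fin 3) K) = frameElt σ f b α β) (t a c' : ℕ) (b : Fin 4) :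
    {M : Submodule 𝒪[K] (Fin 3 → K) | IsVertexLattice σ ϖ ((StdForm.antidiagonal 3).over K) t M ∧ mapGL (Γ b) M = M ∧
        (LatticeInLevel ϖ a ((Γ b : Matrix (Fin 3) (Fin 3) K) - 1) M ∧
          LatticeInLevel ϖ c' (((Γ b : Matrix (Fin 3) (Fin 3) K) - 1) * ((Γ b : Matrix (Fin 3) (Fin 3) K) - 1)) M)}.ncard =
      {M : Submodule 𝒪[K] (Fin 3 → K) |
        IsVertexLattice σ ϖ (Matrix.diagonal fun j => if (![(![false, false, true, true] : Fin 4 → Bool) b, (![false, true, false, true] : Fin 4 → Bool) b,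
            xor ((![false, true, true, false] : Fin 4 → Bool) b) (decide (normSign σ (-1 : K) = -1))] : Fin 3 → Bool) j then c else (1 : K)) t M ∧
          mapGL T M = M ∧
          (LatticeInLevel ϖ a (Matrix.diagonal ![α - 1, β - 1, 0]) M ∧
            LatticeInLevel ϖ c' (Matrix.diagonal ![(α - 1) * (α - 1), (β - 1) * (β - 1), 0]) M)}.ncard := by
  classical
  have hc0 : c ≠ 0 := fun h => by rw [h, map_zero] at hvc; exact zero_ne_one hvc
  set ω : Bool := decide (normSign σ (-1 : K) = -1) with hω_def
  let e1 : Fin 4 → Bool := ![false, false, true, true]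
  let e2 : Fin 4 → Bool := ![false, true, false, true]
  let e12 : Fin 4 → Bool := ![false, true, true, false]
  let sb : Fin 4 → Fin 3 → Bool := fun b => ![e1 b, e2 b, xor (e12 b) ω]
  -- ★ p858764: the model `ᵗσ(A)Φ₃A = diag(d)`, `Γ_b = A·T·A⁻¹`, and the levels count with diagonal operators
  obtain ⟨A, d, hd1, hσd, hcls, hA, hconj, -⟩ := exists_diagonal_model_frame hσ hvσ hϖ heven hf b
  have hΓ' : Γ b = A * T * A⁻¹ := eq_conj_of_coe_eq_frameElt hconj hT (hΓ b)
  have hD₁ : (Matrix.diagonal fun i => ![α, β, 1] i - 1) = Matrix.diagonal ![α - 1, β - 1, 0] := by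
    rw [← diagonal_sub_one, diagonal_three_sub_one, sub_self]
  have hD₂ : (Matrix.diagonal fun i => (![α, β, 1] i - 1) * (![α, β, 1] i - 1)) = Matrix.diagonal ![(α - 1) * (α - 1), (β - 1) * (β - 1), 0] := by
    rw [← diagonal_sub_one_mul_self, diagonal_three_sub_one_mul_self, sub_self, mul_zero]
  rw [ncard_levels_conj_diagonal σ ϖ hA hΓ' hT, hD₁, hD₂]
  -- the classes of `d`: `(ε₁, ε₂, ω(−1) ε₁ ε₂)`, i.e. `normSign σ (d i) = -1 ↔ sb b i`
  obtain ⟨-, -, h0, h1, h2⟩ := hf b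
  have hd0 : ∀ i, d i ≠ 0 := fun i h => by
    have := hd1 i; rw [h, map_zero] at this; exact zero_ne_one this
  have hsign : ∀ i : Fin 3, (normSign σ (d i) = -1 ↔ sb b i = true) := by
    have hωcases := normSign_eq_one_or σ (-1 : K)
    intro i
    fin_cases i
    · change normSign σ (d 0) = -1 ↔ e1 b = true
      rw [hcls 0, h0]
      fin_cases b <;> simp [e1, signPair]
    · change normSign σ (d 1) = -1 ↔ e2 b = true
      rw [hcls 1, h1]
      fin_cases b <;> simp [e2, signPair]
    · change normSign σ (d 2) = -1 ↔ xor (e12 b) ω = true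
      rw [hcls 2, h2]
      rcases hωcases with hp | hm
      · have hωf : ω = false := by
          rw [hω_def, decide_eq_false_iff_not, hp]; norm_num
        rw [hp, hωf]
        fin_cases b <;> simp [e12, signPair]
      · have hωt : ω = true := by rw [hω_def, decide_eq_true_eq, hm]
        rw [hm, hωt]
        fin_cases b <;> simp [e12, signPair]
  -- transport `diag(d)` to the representative form `diag(d_{sb b})` by (C) with the levels label
  refine ncard_vertex_fixed_sep_diagonal_eq_of_exists_norm σ ϖ (d := fun i => if sb b i then c else (1 : K)) (d' := d) (fun i => ?_) _ T hT t _
    (fun P z hP M => levels_diagonalGL_mapGL_iff ϖ a c' _ _ P z hP M)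
  obtain ⟨z, hz0, hz⟩ := exists_rep_of_dichotomy σ hσc hc0 hdich (hσd i) (hd0 i)
  refine ⟨z, hz0, ?_⟩
  by_cases hs : sb b i = true
  · rw [if_pos ((hsign i).2 hs)] at hz
    simpa [hs] using hz
  · have hns : ¬ normSign σ (d i) = -1 := fun h => hs ((hsign i).1 h)
    rw [if_neg hns] at hz
    simpa [hs] using hz

/-! ## §4  The heads for the levels census, and the composite with the labelled Stage A -/

/-- **HEAD (S side) — THE EIGHTFOLD SYMMETRISATION OF THE FOUR-FRAME LEVELS CENSUS**: same data,
`2·Σ_b #{M : type t for Φ₃, Γ_b·M = M, (Γ_b−1)M ⊆ ϖ^aM, (Γ_b−1)²M ⊆ ϖ^{c′}M} = Σ_s #{M : type t for diag(d_s), T·M = M, D₁M ⊆ ϖ^aM, D₂M ⊆ ϖ^{c′}M}` (labelled twin of ★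
`two_mul_sum_fixedVertexCount_eq_sum_signClasses`). [cite: Rogawski1990, §3.6 pp. 28–29; §4.9 Prop. 4.9.1 (a) p. 55] [cite: LanglandsShelstad1987, §1.3] [cite: Jacobowitz1962, §4] -/
theorem two_mul_sum_levelsCount_eq_sum_signClasses (hσ : ∀ x, σ (σ x) = x) (hvσ : ∀ a, Valued.v (σ a) = Valued.v a)
    (hϖ : Valued.v ϖ = WithZero.exp (-1 : ℤ)) (heven : ∀ x : K, σ x = x → x ≠ 0 → ∃ n : ℤ, Valued.v x = WithZero.exp (2 * n))
    {c : K} (hσc : σ c = c) (hvc : Valued.v c = 1)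
    (hdich : ∀ x : K, σ x = x → x ≠ 0 → (∃ z : K, z * σ z = x) ∨ ∃ z : K, z * σ z = c * x)
    {f : Fin 4 → Fin 3 → (Fin 3 → K)} (hf : IsFourFrameFamily σ f) (α β : K)
    (T : GL (Fin 3) K) (hT : (T : Matrix (Fin 3) (Fin 3) K) = Matrix.diagonal ![α, β, 1])
    (Γ : Fin 4 → GL (Fin 3) K) (hΓ : ∀ b, (Γ b : Matrix (Fin 3) (Fin 3) K) = frameElt σ f b α β) (t a c' : ℕ) :
    2 * ∑ b : Fin 4, {M : Submodule 𝒪[K] (Fin 3 → K) | IsVertexLattice σ ϖ ((StdForm.antidiagonal 3).over K) t M ∧ mapGL (Γ b) M = M ∧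
        (LatticeInLevel ϖ a ((Γ b : Matrix (Fin 3) (Fin 3) K) - 1) M ∧
          LatticeInLevel ϖ c' (((Γ b : Matrix (Fin 3) (Fin 3) K) - 1) * ((Γ b : Matrix (Fin 3) (Fin 3) K) - 1)) M)}.ncard =
      ∑ s : Fin 3 → Bool, {M : Submodule 𝒪[K] (Fin 3 → K) |
        IsVertexLattice σ ϖ (Matrix.diagonal fun j => if s j then c else (1 : K)) t M ∧ mapGL T M = M ∧
          (LatticeInLevel ϖ a (Matrix.diagonal ![α - 1, β - 1, 0]) M ∧
            LatticeInLevel ϖ c' (Matrix.diagonal ![(α - 1) * (α - 1), (β - 1) * (β - 1), 0]) M)}.ncard :=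
  two_mul_sum_eq_sum_signClasses_of_frame_counts hσc hvc _ T hT t _ (fun P z hP M => levels_diagonalGL_mapGL_iff ϖ a c' _ _ P z hP M) _
    fun b => ncard_levels_frameElt_eq_ncard_signClass hσ hvσ hϖ heven hσc hvc hdich hf α β T hT Γ hΓ t a c' b

/-- **HEAD (κ side) — THE κ-WEIGHTED EIGHTFOLD SYMMETRISATION OF THE FOUR-FRAME LEVELS CENSUS, EVERY SLOT `i`**: same data,
`2·Σ_b κ_i(b)·levels(Γ_b) = Σ_s χ_i(s)·C_levels(s)` (labelled twin of ★ `two_mul_sum_kappaChar_mul_fixedVertexCount_eq_sum_signClasses`).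
[cite: Rogawski1990, §4.9 Prop. 4.9.1 (a) p. 55] [cite: LanglandsShelstad1987, §1.3] [cite: Jacobowitz1962, §4] -/
theorem two_mul_sum_kappaChar_mul_levelsCount_eq_sum_signClasses (hσ : ∀ x, σ (σ x) = x) (hvσ : ∀ a, Valued.v (σ a) = Valued.v a)
    (hϖ : Valued.v ϖ = WithZero.exp (-1 : ℤ)) (heven : ∀ x : K, σ x = x → x ≠ 0 → ∃ n : ℤ, Valued.v x = WithZero.exp (2 * n))
    {c : K} (hσc : σ c = c) (hvc : Valued.v c = 1)
    (hdich : ∀ x : K, σ x = x → x ≠ 0 → (∃ z : K, z * σ z = x) ∨ ∃ z : K, z * σ z = c * x)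
    {f : Fin 4 → Fin 3 → (Fin 3 → K)} (hf : IsFourFrameFamily σ f) (α β : K)
    (T : GL (Fin 3) K) (hT : (T : Matrix (Fin 3) (Fin 3) K) = Matrix.diagonal ![α, β, 1])
    (Γ : Fin 4 → GL (Fin 3) K) (hΓ : ∀ b, (Γ b : Matrix (Fin 3) (Fin 3) K) = frameElt σ f b α β) (t a c' : ℕ) (i : Fin 3) :
    2 * ∑ b : Fin 4, kappaChar i b *
        ({M : Submodule 𝒪[K] (Fin 3 → K) | IsVertexLattice σ ϖ ((StdForm.antidiagonal 3).over K) t M ∧ mapGL (Γ b) M = M ∧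
          (LatticeInLevel ϖ a ((Γ b : Matrix (Fin 3) (Fin 3) K) - 1) M ∧
            LatticeInLevel ϖ c' (((Γ b : Matrix (Fin 3) (Fin 3) K) - 1) * ((Γ b : Matrix (Fin 3) (Fin 3) K) - 1)) M)}.ncard : ℤ) =
      ∑ s : Fin 3 → Bool,
        (![(if s 1 then -1 else 1) * (if s 2 then -1 else 1) * normSign σ (-1),
           (if s 0 then -1 else 1) * (if s 2 then -1 else 1) * normSign σ (-1),
           (if s 0 then -1 else 1) * (if s 1 then -1 else 1)] : Fin 3 → ℤ) i *
        ({M : Submodule 𝒪[K] (Fin 3 → K) |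
          IsVertexLattice σ ϖ (Matrix.diagonal fun j => if s j then c else (1 : K)) t M ∧ mapGL T M = M ∧
            (LatticeInLevel ϖ a (Matrix.diagonal ![α - 1, β - 1, 0]) M ∧
              LatticeInLevel ϖ c' (Matrix.diagonal ![(α - 1) * (α - 1), (β - 1) * (β - 1), 0]) M)}.ncard : ℤ) :=
  two_mul_sum_kappaChar_mul_eq_sum_signClasses_of_frame_counts hσc hvc _ T hT t _ (fun P z hP M => levels_diagonalGL_mapGL_iff ϖ a c' _ _ P z hP M) _
    (fun b => ncard_levels_frameElt_eq_ncard_signClass hσ hvσ hϖ heven hσc hvc hdich hf α β T hT Γ hΓ t a c' b) i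

/-- **HEAD — THE STABLE FOUR-FRAME LEVELS CENSUS IS `4·` THE LABELLED STAGE-B SUM.**  Same data, finite residue field, `c` moreover a NON-norm (so that ★ (O2b)-MULT M3
applies) and `(α, β, 1)` pairwise-distinct units (★ `v_diag_eq_one` ∕ `diag_regular` of an element datum): for every vertex type `t` and levels `(a, c′)`,
`Σ_b #{M : type t for Φ₃, Γ_b·M = M, (Γ_b−1)M ⊆ ϖ^aM, (Γ_b−1)²M ⊆ ϖ^{c′}M} = 4 · Σᶠ_{M₀ ∈ 𝓛₀(T), D₁M₀ ⊆ ϖ^aM₀ ∧ D₂M₀ ⊆ ϖ^{c′}M₀} polarisationCount σ ϖ t M₀ · stabiliserWeight σ M₀`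
over `ℚ` (§4 (S side) + ★ p858820 `sum_ncard_fixed_vertices_levels_eq_eight_mul_finsum`).  The STABLE level law (F2)∕(F3) is thus the labelled B10: a closed form for the right-hand
`finsum`. [cite: Kottwitz1986BaseChangeUnits, §1 pp. 240–241] [cite: Rogawski1990, §4.9 Prop. 4.9.1 (a)(b) p. 55] [cite: LanglandsShelstad1987, §1.3] -/
theorem sum_levelsCount_eq_four_mul_finsum_polarisationCount_mul_stabiliserWeight [Finite 𝓀[K]] (hσ : ∀ x, σ (σ x) = x)
    (hvσ : ∀ a, Valued.v (σ a) = Valued.v a) (hϖ : Valued.v ϖ = WithZero.exp (-1 : ℤ)) (ϖu : Kˣ) (hϖu : (ϖu : K) = ϖ)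
    (heven : ∀ x : K, σ x = x → x ≠ 0 → ∃ n : ℤ, Valued.v x = WithZero.exp (2 * n))
    {c : K} (hσc : σ c = c) (hvc : Valued.v c = 1) (hcn : ¬ ∃ z : K, z * σ z = c)
    (hdich : ∀ x : K, σ x = x → x ≠ 0 → (∃ z : K, z * σ z = x) ∨ ∃ z : K, z * σ z = c * x)
    {f : Fin 4 → Fin 3 → (Fin 3 → K)} (hf : IsFourFrameFamily σ f) {α β : K}
    (hs : ∀ i : Fin 3, Valued.v ((![α, β, 1] : Fin 3 → K) i) = 1) (hreg : ∀ i j : Fin 3, i ≠ j → (![α, β, 1] : Fin 3 → K) i ≠ (![α, β, 1] : Fin 3 → K) j)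
    (T : GL (Fin 3) K) (hT : (T : Matrix (Fin 3) (Fin 3) K) = Matrix.diagonal ![α, β, 1])
    (Γ : Fin 4 → GL (Fin 3) K) (hΓ : ∀ b, (Γ b : Matrix (Fin 3) (Fin 3) K) = frameElt σ f b α β) (t a c' : ℕ) :
    (((∑ b : Fin 4, {M : Submodule 𝒪[K] (Fin 3 → K) | IsVertexLattice σ ϖ ((StdForm.antidiagonal 3).over K) t M ∧ mapGL (Γ b) M = M ∧
        (LatticeInLevel ϖ a ((Γ b : Matrix (Fin 3) (Fin 3) K) - 1) M ∧
          LatticeInLevel ϖ c' (((Γ b : Matrix (Fin 3) (Fin 3) K) - 1) * ((Γ b : Matrix (Fin 3) (Fin 3) K) - 1)) M)}.ncard : ℕ) : ℚ)) =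
      4 * ∑ᶠ M₀ ∈ {M | M ∈ normalisedStableLattices T ∧
          (LatticeInLevel ϖ a (Matrix.diagonal ![α - 1, β - 1, 0]) M ∧ LatticeInLevel ϖ c' (Matrix.diagonal ![(α - 1) * (α - 1), (β - 1) * (β - 1), 0]) M)},
        (polarisationCount σ ϖ t M₀ : ℚ) * stabiliserWeight σ M₀ := by
  have h2 := two_mul_sum_levelsCount_eq_sum_signClasses hσ hvσ hϖ heven hσc hvc hdich hf α β T hT Γ hΓ t a c'
  have h8 := sum_ncard_fixed_vertices_levels_eq_eight_mul_finsum hσ hvσ hϖ ϖu hϖu hσc hvc hcn hdich hs hreg T hT t a c'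
    ![α - 1, β - 1, 0] ![(α - 1) * (α - 1), (β - 1) * (β - 1), 0]
  have h2q : (2 : ℚ) * ((∑ b : Fin 4, {M : Submodule 𝒪[K] (Fin 3 → K) | IsVertexLattice σ ϖ ((StdForm.antidiagonal 3).over K) t M ∧ mapGL (Γ b) M = M ∧
        (LatticeInLevel ϖ a ((Γ b : Matrix (Fin 3) (Fin 3) K) - 1) M ∧
          LatticeInLevel ϖ c' (((Γ b : Matrix (Fin 3) (Fin 3) K) - 1) * ((Γ b : Matrix (Fin 3) (Fin 3) K) - 1)) M)}.ncard : ℕ) : ℚ) =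
      8 * ∑ᶠ M₀ ∈ {M | M ∈ normalisedStableLattices T ∧
          (LatticeInLevel ϖ a (Matrix.diagonal ![α - 1, β - 1, 0]) M ∧ LatticeInLevel ϖ c' (Matrix.diagonal ![(α - 1) * (α - 1), (β - 1) * (β - 1), 0]) M)},
        (polarisationCount σ ϖ t M₀ : ℚ) * stabiliserWeight σ M₀ := by
    rw [← h8]
    exact_mod_cast congrArg (fun n : ℕ => (n : ℚ)) h2
  linarith

end Levels

end Summit.HodgeConjecture.HodgeConjecture.Cruxes.H413.F0P3cDyRamLevelSumSignClasses

end
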